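import Summits.HodgeConjecture.CorCM.Census.QuaternionColumnFamily
import Summits.HodgeConjecture.CorCM.Census.BlockParityTransfer

/-!
# The quaternion column, VI-a: parity of the potential and the potential of the coincidence types

COR-CM (cell `pub-hodgecm2`), count-neutral kernel combinatorics by the binder seat b09 (gen 39; lane QUATERNION COLUMN), part VI-a, on parts
I–V (`Census/QuaternionColumn{Biarc,Circle,Chains,Potential,Family}.lean`), `Census/BlockParityTransfer.lean`
(`invariant_iff_forall_pow_eq_one`: the weight parity is block-invariant iff `g^{|G|/2} = 1`), parts C/M (`bpot_le`, `exists_bpot_eq`,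
`exists_rt_of_bpot_eq_zero`) and `TwistGeneration.ddist_oflipCM_of_not_mem` used BY NAME.  Theorems only: no definition, no `decide` beyond
closed identities in `𝔽₂`, no certificate, no named fact, no `sorry`.
HONEST FRAMING: `HC_CM` is NOT proved, here or anywhere in the tree; nothing here is a period or a headline.

CONTENT (`n` even where stated; `T₀ = barc 0 0`).
* §1 **Parity of the potential**: for even `n` every `g ∈ Q_{4n}` has `g^{2n} = 1`, so the weight parity is block-invariant and
  `bpot Ψ ≡ ddist T₀ Ψ (mod 2)` (`natCast_bpot_eq`); a type at distance `2` from `T₀` which is not a base change has potential EXACTLY `2`.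
* §2 **No biarc has a hole**: `a v ∈ Φ, a (v+1) ∉ Φ, a (v+2) ∈ Φ` is impossible for a biarc (`not_sandwich_a`, `_xa`); hence the coincidence
  types `C_i = T₀^{(a 0)(a (i+1))}` (`1 ≤ i ≤ n−2`) and `C'_j = T₀^{(a 0)(xa (j+1))}` (`1 ≤ j ≤ n−3`) have potential `2 = ddist T₀` (`bpot_C`, `bpot_C'`).

## References
* [Pohlmann1968] H. Pohlmann, Algebraic cycles on abelian varieties of complex multiplication type, Ann. of Math. 88 (1968), Thm 1.
-/

namespace Summit.HodgeConjecture.CorCM.Census.QuaternionColumn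

open Finset QuaternionGroup
open Summit.HodgeConjecture.CorCM.Prior.AllgGroup.RfwfAllgGroup
open Summit.HodgeConjecture.CorCM.Census.BlockParity
open Summit.HodgeConjecture.CorCM.Census.Coinvariant
open Summit.HodgeConjecture.CorCM.Census.Nondegenerate
open Summit.HodgeConjecture.CorCM.Census.BaseBlock
open Summit.HodgeConjecture.CorCM.Census.TwistGeneration

noncomputable section

variable {n : ℕ} [NeZero n]

/-! ## §1 Parity of the potential -/

/-- For even `n`, **every element of `Q_{4n}` satisfies `g^{2n} = 1`** (the exponent is `2n`). [folklore] -/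
theorem pow_two_n_eq_one (heven : Even n) (g : QuaternionGroup n) : g ^ (2 * n) = 1 := by
  cases g with
  | a i =>
    have h : (a i : QuaternionGroup n) = (a 1) ^ i.val := by rw [a_one_pow, ZMod.natCast_zmod_val]
    rw [h, ← pow_mul, pow_mul', a_one_pow_n, one_pow]
  | xa i =>
    obtain ⟨m, hm⟩ := heven
    have h2 : (xa i : QuaternionGroup n) ^ 2 = c n := xa_sq i
    rw [pow_mul, h2, hm, ← two_mul, pow_mul, sq, c_mul_c, one_pow]

/-- **The weight parity of `T₀ = barc 0 0` is block-invariant** (even `n`). [folklore] -/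
theorem wpar_rt_eq (heven : Even n) (Q : QuaternionGroup n) (Ψ : CMF (QuaternionGroup n) (c n)) :
    wpar (c n) (barc 0 0) (rt (c n) Q Ψ) = wpar (c n) (barc 0 0) Ψ := by
  have h := (invariant_iff_forall_pow_eq_one (c n) c_mul_c c_ne_one c_comm (barc (0 : ZMod (2 * n)) 0)).mpr (fun g => by
    rw [QuaternionGroup.card, show 4 * n / 2 = 2 * n by omega]; exact pow_two_n_eq_one heven g)
  exact h Q Ψ

/-- **Parity of the potential**: `bpot Ψ ≡ ddist T₀ Ψ (mod 2)` (even `n`). [folklore] -/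
theorem natCast_bpot_eq (heven : Even n) (Ψ : CMF (QuaternionGroup n) (c n)) :
    ((bpot (c n) (barc 0 0) Ψ : ℕ) : ZMod 2) = ((ddist (barc (0 : ZMod (2 * n)) 0) Ψ : ℕ) : ZMod 2) := by
  obtain ⟨Q, hQ⟩ := exists_bpot_eq (c n) (barc (0 : ZMod (2 * n)) 0) Ψ
  have e : ddist (rt (c n) Q (barc 0 0)) Ψ = ddist (barc (0 : ZMod (2 * n)) 0) (rt (c n) Q⁻¹ Ψ) := by
    conv_lhs => rw [← rt_rt_inv (c n) Q Ψ]
    rw [ddist_rt]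
  rw [hQ, e]
  exact wpar_rt_eq heven Q⁻¹ Ψ

/-- **A non-base type at distance two from `T₀` has potential exactly `2`** (even `n`). [folklore] -/
theorem bpot_eq_two (heven : Even n) {Ψ : CMF (QuaternionGroup n) (c n)} (hd : ddist (barc (0 : ZMod (2 * n)) 0) Ψ = 2)
    (h0 : bpot (c n) (barc 0 0) Ψ ≠ 0) : bpot (c n) (barc 0 0) Ψ = 2 := by
  have hle : bpot (c n) (barc 0 0) Ψ ≤ 2 := by
    have h := bpot_le (c n) (barc (0 : ZMod (2 * n)) 0) Ψ 1; rw [rt_one, hd] at h; exact h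
  have hpar := natCast_bpot_eq heven Ψ
  rw [hd] at hpar
  have h1 : bpot (c n) (barc 0 0) Ψ ≠ 1 := by
    intro h; rw [h] at hpar; revert hpar; decide
  omega

/-! ## §2 No biarc has a hole; the potential of the coincidence types -/

/-- `val (v + 1) = val v + 1` below the wrap. [folklore] -/
theorem val_add_one_eq {v : ZMod (2 * n)} (h : v.val + 1 < 2 * n) : (v + 1).val = v.val + 1 := by
  rw [ZMod.val_add_of_lt (by rw [val_one_eq]; exact h), val_one_eq]

/-- **No biarc has a rotation hole**: `a v ∈ barc p q`, `a (v+1) ∉ barc p q`, `a (v+2) ∈ barc p q` is impossible (`n ≥ 2`). [folklore] -/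
theorem not_sandwich_a (h2 : 2 ≤ n) (p q v : ZMod (2 * n)) (hv : (a v : QuaternionGroup n) ∈ (barc p q).1)
    (hv1 : (a (v + 1) : QuaternionGroup n) ∉ (barc p q).1) : (a (v + 2) : QuaternionGroup n) ∉ (barc p q).1 := by
  rw [a_mem_barc] at hv hv1 ⊢
  rw [show v + 1 - p = (v - p) + 1 by ring] at hv1
  rw [show v + 2 - p = (v - p) + 1 + 1 by ring]
  have e1 : (v - p + 1).val = (v - p).val + 1 := val_add_one_eq (by omega)
  rw [e1] at hv1
  have e2 : (v - p + 1 + 1).val = (v - p).val + 1 + 1 := by rw [val_add_one_eq (by rw [e1]; omega), e1]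
  rw [e2]; omega

/-- **No biarc has a reflection hole.** [folklore] -/
theorem not_sandwich_xa (h2 : 2 ≤ n) (p q v : ZMod (2 * n)) (hv : (xa v : QuaternionGroup n) ∈ (barc p q).1)
    (hv1 : (xa (v + 1) : QuaternionGroup n) ∉ (barc p q).1) : (xa (v + 2) : QuaternionGroup n) ∉ (barc p q).1 := by
  rw [xa_mem_barc] at hv hv1 ⊢
  rw [show v + 1 - q = (v - q) + 1 by ring] at hv1
  rw [show v + 2 - q = (v - q) + 1 + 1 by ring]
  have e1 : (v - q + 1).val = (v - q).val + 1 := val_add_one_eq (by omega)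
  rw [e1] at hv1
  have e2 : (v - q + 1 + 1).val = (v - q).val + 1 + 1 := by rw [val_add_one_eq (by rw [e1]; omega), e1]
  rw [e2]; omega

/-- Membership in a flipped type off the flipped place. [folklore] -/
theorem mem_oflipCM_of_notMem_orb {t x : QuaternionGroup n} (hx : x ∉ orb (c n) t) (Ψ : CMF (QuaternionGroup n) (c n)) :
    x ∈ (oflipCM (c n) c_mul_c t Ψ).1 ↔ x ∈ Ψ.1 := by
  rw [mem_oflipCM_iff' c_mul_c]; tauto

/-- Membership of the flipped element itself. [folklore] -/
theorem mem_oflipCM_self (t : QuaternionGroup n) (Ψ : CMF (QuaternionGroup n) (c n)) :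
    t ∈ (oflipCM (c n) c_mul_c t Ψ).1 ↔ t ∉ Ψ.1 := by
  rw [mem_oflipCM_iff' c_mul_c]
  have h : t ∈ orb (c n) t := by rw [mem_orb]; exact Or.inl rfl
  tauto

/-- Membership of the partner `c·t` of the flipped element. [folklore] -/
theorem cmul_mem_oflipCM_self (t : QuaternionGroup n) (Ψ : CMF (QuaternionGroup n) (c n)) :
    c n * t ∈ (oflipCM (c n) c_mul_c t Ψ).1 ↔ c n * t ∉ Ψ.1 := by
  rw [mem_oflipCM_iff' c_mul_c]
  have h : c n * t ∈ orb (c n) t := by rw [mem_orb]; exact Or.inr rfl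
  tauto

omit [NeZero n] in
/-- A rotation is never in the place of a reflection and vice versa. [folklore] -/
theorem a_notMem_orb_xa (i j : ZMod (2 * n)) : (a i : QuaternionGroup n) ∉ orb (c n) (xa j) := by
  rw [mem_orb, (c_mul_a j).2]; rintro (h | h) <;> cases h

/-- **Deviation distance two**: flipping `T₀` at two distinct places gives a type at distance `2` from `T₀`
(stated for the two shapes `T₀^{(a 0)(a (i+1))}`, `T₀^{(a 0)(xa (j+1))}` of the coincidence types). [folklore] -/
theorem ddist_C (i : ℕ) (h1 : 1 ≤ i) (h2 : i + 2 ≤ n) :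
    ddist (barc (0 : ZMod (2 * n)) 0) (oflipCM (c n) c_mul_c (a 0) (oflipCM (c n) c_mul_c (a ((i : ZMod (2 * n)) + 1)) (barc 0 0))) = 2 ∧
      ∀ j : ℕ, j + 2 ≤ n →
        ddist (barc (0 : ZMod (2 * n)) 0) (oflipCM (c n) c_mul_c (a 0) (oflipCM (c n) c_mul_c (xa ((j : ZMod (2 * n)) + 1)) (barc 0 0))) = 2 := by
  have han : (a (n : ZMod (2 * n)) : QuaternionGroup n) ∉ (barc (0 : ZMod (2 * n)) 0).1 := by
    rw [a_mem_barc, sub_zero, val_n]; exact lt_irrefl n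
  have step0 : ∀ Ψ : CMF (QuaternionGroup n) (c n), (a (n : ZMod (2 * n)) : QuaternionGroup n) ∉ Ψ.1 →
      ddist (barc (0 : ZMod (2 * n)) 0) (oflipCM (c n) c_mul_c (a 0) Ψ) = ddist (barc (0 : ZMod (2 * n)) 0) Ψ + 1 := by
    intro Ψ hΨ
    have e : (a 0 : QuaternionGroup n) = c n * a (n : ZMod (2 * n)) := by rw [(c_mul_a _).1, two_n_eq_zero]
    rw [e, oflipCM_cmul]
    exact ddist_oflipCM_of_not_mem c_mul_c hΨ han
  refine ⟨?_, fun j hj => ?_⟩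
  · have hi1n : (a ((i : ZMod (2 * n)) + 1 + (n : ZMod (2 * n))) : QuaternionGroup n) ∉ (barc (0 : ZMod (2 * n)) 0).1 := by
      rw [a_mem_barc, sub_zero, ← Nat.cast_succ, ← Nat.cast_add, val_natCast_of_lt (by omega)]; omega
    have e : (a ((i : ZMod (2 * n)) + 1) : QuaternionGroup n) = c n * a ((i : ZMod (2 * n)) + 1 + (n : ZMod (2 * n))) := by
      rw [(c_mul_a _).1, add_assoc, add_assoc, two_n_eq_zero, add_zero]
    rw [step0, e, oflipCM_cmul, ddist_oflipCM_of_not_mem c_mul_c hi1n hi1n, ddist_self]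
    rw [e, oflipCM_cmul, mem_oflipCM_of_notMem_orb]
    · exact han
    · refine a_notMem_orb_a ?_ ?_
      · rw [← Nat.cast_succ, ← Nat.cast_add]; exact natCast_ne_of_lt (by omega) (by omega) (by omega)
      · rw [add_assoc ((i : ZMod (2 * n)) + 1), two_n_eq_zero, add_zero, ← Nat.cast_succ]
        exact natCast_ne_of_lt (by omega) (by omega) (by omega)
  · have hj1n : (xa ((j : ZMod (2 * n)) + 1 + (n : ZMod (2 * n))) : QuaternionGroup n) ∉ (barc (0 : ZMod (2 * n)) 0).1 := by
      rw [xa_mem_barc, sub_zero, ← Nat.cast_succ, ← Nat.cast_add, val_natCast_of_lt (by omega)]; omega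
    have e : (xa ((j : ZMod (2 * n)) + 1) : QuaternionGroup n) = c n * xa ((j : ZMod (2 * n)) + 1 + (n : ZMod (2 * n))) := by
      rw [(c_mul_a _).2, add_assoc, add_assoc, two_n_eq_zero, add_zero]
    rw [step0, e, oflipCM_cmul, ddist_oflipCM_of_not_mem c_mul_c hj1n hj1n, ddist_self]
    rw [mem_oflipCM_of_notMem_orb (a_notMem_orb_xa _ _)]
    exact han

/-- **Potential zero means biarc**: a type of potential `0` is a base change of `T₀`, hence a biarc. [folklore] -/
theorem exists_barc_of_bpot_eq_zero {Ψ : CMF (QuaternionGroup n) (c n)} (h : bpot (c n) (barc 0 0) Ψ = 0) :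
    ∃ p q : ZMod (2 * n), Ψ = barc p q := by
  obtain ⟨Q, rfl⟩ := exists_rt_of_bpot_eq_zero (c n) (barc (0 : ZMod (2 * n)) 0) h
  obtain ⟨p, hp | hp⟩ := rt_base_cases (n := n) Q
  · exact ⟨p, p, hp⟩
  · exact ⟨p, _, hp⟩

/-- **The rotation coincidence type `C_i = T₀^{(a 0)(a (i+1))}` has potential `2 = ddist T₀ C_i`** (`1 ≤ i ≤ n−2`, `n` even). [folklore] -/
theorem bpot_C (heven : Even n) (i : ℕ) (h1 : 1 ≤ i) (h2 : i + 2 ≤ n) :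
    bpot (c n) (barc 0 0) (oflipCM (c n) c_mul_c (a 0) (oflipCM (c n) c_mul_c (a ((i : ZMod (2 * n)) + 1)) (barc 0 0))) = 2 := by
  refine bpot_eq_two heven (ddist_C i h1 h2).1 fun h0 => ?_
  obtain ⟨p, q, hpq⟩ := exists_barc_of_bpot_eq_zero h0
  -- the hole `a i ∈, a (i+1) ∉, a (i+2) ∈`
  have hii : (a (i : ZMod (2 * n)) : QuaternionGroup n) ∉ orb (c n) (a ((i : ZMod (2 * n)) + 1)) := by
    refine a_notMem_orb_a ?_ ?_
    · rw [← Nat.cast_succ]; exact natCast_ne_of_lt (by omega) (by omega) (by omega)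
    · rw [← Nat.cast_succ, ← Nat.cast_add]; exact natCast_ne_of_lt (by omega) (by omega) (by omega)
  have hi0 : ∀ k : ℕ, 1 ≤ k → k < n → (a (k : ZMod (2 * n)) : QuaternionGroup n) ∉ orb (c n) (a 0) := by
    intro k hk1 hk2
    refine a_notMem_orb_a ?_ ?_
    · rw [← Nat.cast_zero]; exact natCast_ne_of_lt (by omega) (by omega) (by omega)
    · rw [zero_add]; exact natCast_ne_of_lt (by omega) (by omega) (by omega)
  have hin : (a (i : ZMod (2 * n)) : QuaternionGroup n) ∈ (barc p q).1 := by
    rw [← hpq, mem_oflipCM_of_notMem_orb (hi0 i h1 (by omega)), mem_oflipCM_of_notMem_orb hii]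
    exact (natCast_mem_base (by omega)).1
  have hout : (a ((i : ZMod (2 * n)) + 1) : QuaternionGroup n) ∉ (barc p q).1 := by
    rw [← hpq, mem_oflipCM_of_notMem_orb (by rw [← Nat.cast_succ]; exact hi0 (i + 1) (by omega) (by omega)), mem_oflipCM_self, not_not,
      ← Nat.cast_succ]
    exact (natCast_mem_base (by omega)).1
  have hin2 : (a ((i : ZMod (2 * n)) + 2) : QuaternionGroup n) ∈ (barc p q).1 := by
    rw [← hpq]
    by_cases hi2 : i + 2 < n
    · have hne : (a ((i : ZMod (2 * n)) + 2) : QuaternionGroup n) ∉ orb (c n) (a ((i : ZMod (2 * n)) + 1)) := by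
        refine a_notMem_orb_a ?_ ?_
        · rw [← Nat.cast_succ, show (i : ZMod (2 * n)) + 2 = ((i + 2 : ℕ) : ZMod (2 * n)) by push_cast; ring]
          exact natCast_ne_of_lt (by omega) (by omega) (by omega)
        · rw [← Nat.cast_succ, ← Nat.cast_add, show (i : ZMod (2 * n)) + 2 = ((i + 2 : ℕ) : ZMod (2 * n)) by push_cast; ring]
          exact natCast_ne_of_lt (by omega) (by omega) (by omega)
      rw [show (i : ZMod (2 * n)) + 2 = ((i + 2 : ℕ) : ZMod (2 * n)) by push_cast; ring,
        mem_oflipCM_of_notMem_orb (hi0 (i + 2) (by omega) hi2), Nat.cast_add, Nat.cast_two,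
        show ((i : ZMod (2 * n)) + 2) = (i : ZMod (2 * n)) + 2 from rfl, mem_oflipCM_of_notMem_orb hne,
        show (i : ZMod (2 * n)) + 2 = ((i + 2 : ℕ) : ZMod (2 * n)) by push_cast; ring]
      exact (natCast_mem_base hi2).1
    · have hieq : (i : ZMod (2 * n)) + 2 = (n : ZMod (2 * n)) := by
        rw [show (i : ZMod (2 * n)) + 2 = ((i + 2 : ℕ) : ZMod (2 * n)) by push_cast; ring, show i + 2 = n by omega]
      have e : (a (n : ZMod (2 * n)) : QuaternionGroup n) = c n * a 0 := by rw [(c_mul_a _).1, zero_add]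
      rw [hieq, e, cmul_mem_oflipCM_self, ← e, mem_oflipCM_of_notMem_orb]
      · rw [a_mem_barc, sub_zero, val_n]; exact lt_irrefl n
      · refine a_notMem_orb_a ?_ ?_
        · rw [← Nat.cast_succ]; exact natCast_ne_of_lt (by omega) (by omega) (by omega)
        · rw [← Nat.cast_succ]; intro h; have h' := congrArg ZMod.val h
          rw [← Nat.cast_add, val_n, val_natCast_of_lt (by omega)] at h'; omega
  exact not_sandwich_a (by omega) p q _ hin hout hin2

/-- **The reflection coincidence type `C'_j = T₀^{(a 0)(xa (j+1))}` has potential `2`** (`1 ≤ j ≤ n−3`, `n` even). [folklore] -/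
theorem bpot_C' (heven : Even n) (j : ℕ) (h1 : 1 ≤ j) (h3 : j + 3 ≤ n) :
    bpot (c n) (barc 0 0) (oflipCM (c n) c_mul_c (a 0) (oflipCM (c n) c_mul_c (xa ((j : ZMod (2 * n)) + 1)) (barc 0 0))) = 2 := by
  refine bpot_eq_two heven ((ddist_C 1 le_rfl (by omega)).2 j (by omega)) fun h0 => ?_
  obtain ⟨p, q, hpq⟩ := exists_barc_of_bpot_eq_zero h0
  have hxx : ∀ k : ℕ, k < n → k ≠ j + 1 → (xa (k : ZMod (2 * n)) : QuaternionGroup n) ∉ orb (c n) (xa ((j : ZMod (2 * n)) + 1)) := by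
    intro k hk hkj
    refine xa_notMem_orb_xa ?_ ?_
    · rw [← Nat.cast_succ]; exact natCast_ne_of_lt (by omega) (by omega) hkj
    · rw [← Nat.cast_succ, ← Nat.cast_add]; exact natCast_ne_of_lt (by omega) (by omega) (by omega)
  have hx0 : ∀ k : ZMod (2 * n), (xa k : QuaternionGroup n) ∉ orb (c n) (a 0) := fun k => by
    rw [mem_orb, (c_mul_a _).1]; rintro (h | h) <;> cases h
  have hin : (xa (j : ZMod (2 * n)) : QuaternionGroup n) ∈ (barc p q).1 := by
    rw [← hpq, mem_oflipCM_of_notMem_orb (hx0 _), mem_oflipCM_of_notMem_orb (hxx j (by omega) (by omega))]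
    exact (natCast_mem_base (by omega)).2
  have hout : (xa ((j : ZMod (2 * n)) + 1) : QuaternionGroup n) ∉ (barc p q).1 := by
    rw [← hpq, mem_oflipCM_of_notMem_orb (hx0 _), mem_oflipCM_self, not_not, ← Nat.cast_succ]
    exact (natCast_mem_base (by omega)).2
  have hin2 : (xa ((j : ZMod (2 * n)) + 2) : QuaternionGroup n) ∈ (barc p q).1 := by
    rw [← hpq, mem_oflipCM_of_notMem_orb (hx0 _), show (j : ZMod (2 * n)) + 2 = ((j + 2 : ℕ) : ZMod (2 * n)) by push_cast; ring,
      mem_oflipCM_of_notMem_orb (hxx (j + 2) (by omega) (by omega))]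
    exact (natCast_mem_base (by omega)).2
  exact not_sandwich_xa (by omega) p q _ hin hout hin2

end

end Summit.HodgeConjecture.CorCM.Census.QuaternionColumn
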